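import Literature.Analysis.Complex.SimilarityPrincipleVector
import Literature.Geometry.Symplectic.JHolomorphicSheetChart
import Literature.Geometry.Symplectic.JHolomorphicChartLocalisation
import Literature.Geometry.Symplectic.JHolomorphicMap
import HarnessLib

/-!
# Critical points of `J`-holomorphic curves are isolated (McDuff 1991, Lemma 2.7)

**Theorem** (D. McDuff, *The local behaviour of holomorphic curves in almost complex 4-manifolds*,
J. Differential Geom. 34 (1991), Lemma 2.7, first statement, p. 150: "All critical points of a
`J`-holomorphic map `f : D → V` are isolated"; McDuff–Salamon, *J-holomorphic curves and
symplectic topology* (2012), Lemma 2.4.1; Wendl, *Lectures on Contact 3-Manifolds, Holomorphic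
Curves and Intersection Theory* (2020), Cor. B.21 / Exercise B.25). Let `(V, J)` be a smooth almost
complex `4`-manifold and `G : ℂ → V` smooth and `J`-holomorphic. If `G` is not locally constant at
`z₀`, then `dG(z)` is injective for all `z ≠ z₀` close to `z₀`.

* `Literature.Geometry.Symplectic.IsJHolomorphic.eventually_injective_mfderiv` — the statement
  above, with the binders of the facts of `JHolomorphicLocalIntersections.lean`;
* `Literature.Geometry.Symplectic.CriticalPoints.eventually_injective_fderiv_of_frequently_ne` —
  its flat form: `E` a real normed space of dimension `4`, `u : ℂ → E` and `Jt : ℂ → End E` smooth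
  near `z₀` with `(Jt z)² = -1` and `∂_y u = Jt z (∂ₓ u)` (the `J`-holomorphicity equation read in
  a chart, `Jt z = J (u z)`).

Proof (McDuff proves Lemma 2.7 from the normal form Prop. 2.6; we follow the route of
McDuff–Salamon Lemma 2.4.1 / Wendl Cor. B.21 through the similarity principle, which the tree
holds as a theorem). Differentiating `∂_y u = Jt ∂ₓ u` in `x` and using the symmetry of second
derivatives, `w₀ = ∂ₓ u` solves the LINEAR equation `∂_y w₀ = Jt ∂ₓ w₀ + (∂ₓ Jt) w₀`. With
`J₀ = Jt z₀` and the frame `Φ = ½(1 - Jt J₀)` (`Jt Φ = Φ J₀`, `Φ z₀ = 1`, invertible near `z₀`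
with inverse `Ψ`; the device of `JHolomorphicUniqueContinuationFlat.lean`), `w = Ψ w₀` satisfies
`∂_y w - J₀ ∂ₓ w = Ψ (Jt (∂ₓΦ) w + (∂ₓJt) Φ w - (∂_yΦ) w)`, hence `‖∂ₓ w + J₀ ∂_y w‖ ≤ C ‖w‖` on a
disc about `z₀`. In complex coordinates `S : ℂ × ℂ ≃ E` adapted to `J₀` (`J₀ S = S i`, built from
`Literature.Geometry.Symplectic.exists_bijective_sheetChartDeriv`) this is the `∂̄`-inequality
`‖∂ₓ v + i ∂_y v‖ ≤ C' ‖v‖` for `v = S⁻¹ w`, and the vector-valued similarity principle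
(`Literature.Analysis.Complex.zeroDichotomy_of_norm_dbar_le_normedSpace`, Carleman–Bers–Vekua)
gives: either `v ≡ 0` near `z₀` — then `du ≡ 0` near `z₀` and `u` is constant near `z₀`, excluded —
or `v ≠ 0` on a punctured neighbourhood, where then `∂ₓ u ≠ 0` and `du(z)`, being
`(Jt z)`-complex-linear, is injective. The manifold statement is read in the chart at `G z₀`
(`JHolomorphicChartLocalisation.lean`).

Everything is proved; no named facts.
-- TODO(general form): McDuff's Lemma 2.7 holds in all dimensions; only `dim V = 4` (complex
-- coordinates `ℂ × ℂ`) is recorded, which is what the local intersection theory of the tree uses.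

## References

* D. McDuff, *The local behaviour of holomorphic curves in almost complex 4-manifolds*,
  J. Differential Geom. 34 (1991) 143–164, Lemma 2.7 p. 150. [McDuff1991LocalBehaviour]
* D. McDuff, D. Salamon, *J-holomorphic curves and symplectic topology*, 2nd ed. (2012),
  Lemma 2.4.1, §2.3. [McDuffSalamon2012]
* C. Wendl, *Lectures on Contact 3-Manifolds, Holomorphic Curves and Intersection Theory* (2020),
  App. B, Thm B.20, Cor. B.21. [Wendl2020]
-/

noncomputable section

open scoped ContDiff Topology Manifold
open Set Filter Metric Function Complex

namespace Literature.Geometry.Symplectic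

namespace CriticalPoints

/-! ### Linear algebra of a complex structure `J₀` on a real `4`-space -/

section LinearAlgebra

variable {E : Type*} [NormedAddCommGroup E] [NormedSpace ℝ E]

/-- If `a • x + b • J x = 0` with `J² = -1` and `x ≠ 0` then `a = b = 0` (apply `J` and combine:
`(a² + b²) • x = 0`). [folklore] -/
theorem eq_zero_of_smul_add_smul_eq_zero (J : E →L[ℝ] E) (hJ : ∀ v, J (J v) = -v) {x : E}
    (hx : x ≠ 0) {a b : ℝ} (h : a • x + b • J x = 0) : a = 0 ∧ b = 0 := by
  have h2 : a • J x - b • x = 0 := by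
    have h' := congrArg J h
    rw [map_add, map_smul, map_smul, hJ, map_zero, smul_neg, ← sub_eq_add_neg] at h'
    exact h'
  have h3 : (a * a + b * b) • x = 0 := by
    have e : (a * a + b * b) • x = a • (a • x + b • J x) - b • (a • J x - b • x) := by
      simp only [smul_add, smul_sub, smul_smul, add_smul, mul_comm b a]
      abel
    rw [e, h, h2, smul_zero, smul_zero, sub_zero]
  have h4 : a * a + b * b = 0 := by
    rcases smul_eq_zero.1 h3 with h | h
    · exact h
    · exact absurd h hx
  constructor <;> nlinarith [mul_self_nonneg a, mul_self_nonneg b]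

/-- A real-linear `L : ℂ → E` intertwining `i` with a complex structure `J` (`L (i ζ) = J (L ζ)`,
`J² = -1`) and with `L 1 ≠ 0` is injective: `L ζ = (Re ζ) • L 1 + (Im ζ) • J (L 1)`.
[folklore] -/
theorem injective_of_map_I_mul (J : E →L[ℝ] E) (hJ : ∀ v, J (J v) = -v) (L : ℂ →L[ℝ] E)
    (hL : ∀ ζ : ℂ, L (I * ζ) = J (L ζ)) (h1 : L 1 ≠ 0) : Injective L := by
  have hrepr : ∀ ζ : ℂ, L ζ = ζ.re • L 1 + ζ.im • J (L 1) := by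
    intro ζ
    have e : ζ = (ζ.re : ℝ) • (1 : ℂ) + (ζ.im : ℝ) • (I * 1) := by
      simp only [Complex.real_smul, mul_one]
      exact (Complex.re_add_im ζ).symm
    conv_lhs => rw [e]
    rw [map_add, map_smul, map_smul, hL]
  refine (injective_iff_map_eq_zero L).2 fun ζ hζ => ?_
  rw [hrepr] at hζ
  obtain ⟨hre, him⟩ := eq_zero_of_smul_add_smul_eq_zero J hJ h1 hζ
  exact Complex.ext (by simpa using hre) (by simpa using him)

/-- **Complex coordinates adapted to a complex structure.** For `J₀` with `J₀² = -1` on a real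
`4`-space `E` there is a real-linear isomorphism `S : ℂ × ℂ ≃ E` with `J₀ ∘ S = S ∘ i`
(a `J₀`-complex basis `e₁, J₀ e₁, ν₀, J₀ ν₀`; here obtained from the sheet-chart differential of
`Literature/Geometry/Symplectic/JHolomorphicSheetChart.lean` along the `J₀`-line through `e₁`).
[folklore] -/
theorem exists_complexCoordinates [FiniteDimensional ℝ E] (h4 : Module.finrank ℝ E = 4)
    (J₀ : E →L[ℝ] E) (hJ₀ : ∀ v, J₀ (J₀ v) = -v) :
    ∃ S : (ℂ × ℂ) ≃L[ℝ] E, ∀ q : ℂ × ℂ, J₀ (S q) = S (I • q) := by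
  -- a nonzero vector and the real-linear `J₀`-complex line through it
  obtain ⟨e₁, he₁⟩ : ∃ e₁ : E, e₁ ≠ 0 := by
    have : Nontrivial E := Module.nontrivial_of_finrank_pos (R := ℝ) (by rw [h4]; norm_num)
    exact exists_ne 0
  set L : ℂ →L[ℝ] E := Complex.reCLM.smulRight e₁ + Complex.imCLM.smulRight (J₀ e₁) with hL
  have hLapply : ∀ ζ : ℂ, L ζ = ζ.re • e₁ + ζ.im • J₀ e₁ := fun ζ => by
    simp [hL]
  have hLI : ∀ ζ : ℂ, L (I * ζ) = J₀ (L ζ) := by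
    intro ζ
    rw [hLapply, hLapply, map_add, map_smul, map_smul, hJ₀]
    simp only [Complex.mul_re, Complex.I_re, Complex.I_im, Complex.mul_im, zero_mul, one_mul,
      zero_sub, zero_add, neg_smul, smul_neg]
    abel
  have hL1 : L 1 ≠ 0 := by rw [hLapply]; simpa using he₁
  have hLinj : Injective L := injective_of_map_I_mul J₀ hJ₀ L hLI hL1
  have hfd : fderiv ℝ (fun z : ℂ => L z) 0 = L := L.fderiv
  obtain ⟨ν₀, hν₀⟩ := exists_bijective_sheetChartDeriv h4 (J := fun _ : E => J₀)
    (b := fun z : ℂ => L z) (z₁ := 0) (by rw [hfd]; exact hLinj)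
    (fun α => by rw [hfd]; exact hLI α) hJ₀
  set T : ℂ × ℂ →L[ℝ] E := sheetChartDeriv (fun _ : E => J₀) (fun z : ℂ => L z) ν₀ 0 with hT
  have hThol : ∀ α β : ℂ, J₀ (T (α, β)) = T (I * α, I * β) := fun α β =>
    sheetChartDeriv_hol (J := fun _ : E => J₀) (b := fun z : ℂ => L z) (ν₀ := ν₀) (z := 0)
      (fun α => by rw [hfd]; exact hLI α) hJ₀ α β
  let Tl : (ℂ × ℂ) ≃ₗ[ℝ] E := LinearEquiv.ofBijective (T : ℂ × ℂ →ₗ[ℝ] E) hν₀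
  have hTl : ∀ q, Tl q = T q := fun q => rfl
  refine ⟨Tl.toContinuousLinearEquiv, fun q => ?_⟩
  obtain ⟨α, β⟩ := q
  show J₀ (Tl (α, β)) = Tl (I • (α, β))
  rw [hTl, hTl, Prod.smul_mk, smul_eq_mul, smul_eq_mul]
  exact hThol α β

end LinearAlgebra

/-! ### The flat statement -/

section Flat

variable {E : Type*} [NormedAddCommGroup E] [NormedSpace ℝ E] [FiniteDimensional ℝ E]

/-- **Critical points of a flat `J`-holomorphic map are isolated unless it is locally constant**
(McDuff 1991 Lemma 2.7, first statement, in a chart). `E` real of dimension `4`; `u`, `Jt` smooth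
on a neighbourhood `U` of `z₀` with `(Jt z)² = -1` and `∂_y u = Jt z (∂ₓ u)` on `U`; if `u` is
not locally constant at `z₀` then `du(z)` is injective for all `z ≠ z₀` near `z₀`.
[cite: McDuff1991LocalBehaviour, Lemma 2.7] -/
theorem eventually_injective_fderiv_of_frequently_ne (h4 : Module.finrank ℝ E = 4)
    {u : ℂ → E} {Jt : ℂ → E →L[ℝ] E} {z₀ : ℂ} {U : Set ℂ} (hU : U ∈ 𝓝 z₀)
    (hu : ContDiffOn ℝ ∞ u U) (hJt : ContDiffOn ℝ ∞ Jt U)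
    (hJ2 : ∀ z ∈ U, ∀ v, Jt z (Jt z v) = -v)
    (hhol : ∀ z ∈ U, fderiv ℝ u z I = Jt z (fderiv ℝ u z 1))
    (hnc : ∃ᶠ z in 𝓝 z₀, u z ≠ u z₀) :
    ∀ᶠ z in 𝓝[≠] z₀, Injective (fderiv ℝ u z) := by
  haveI : CompleteSpace E := FiniteDimensional.complete ℝ E
  -- an open neighbourhood `U' ⊆ U` of `z₀`
  obtain ⟨U', hU'U, hU'open, hz₀U'⟩ := _root_.mem_nhds_iff.mp hU
  have hz₀U : z₀ ∈ U := hU'U hz₀U'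
  have hU'nhds : ∀ z ∈ U', U' ∈ 𝓝 z := fun z hz => hU'open.mem_nhds hz
  have huU' : ContDiffOn ℝ ∞ u U' := hu.mono hU'U
  have hJtU' : ContDiffOn ℝ ∞ Jt U' := hJt.mono hU'U
  -- the derivative `w₀ = ∂ₓ u` and its linear equation `∂_y w₀ = Jt ∂ₓ w₀ + (∂ₓ Jt) w₀` on `U'`
  have hDu : ContDiffOn ℝ ∞ (fderiv ℝ u) U' := huU'.fderiv_of_isOpen hU'open (by simp)
  obtain ⟨w₀, hw₀_def⟩ : ∃ w₀ : ℂ → E, w₀ = fun z => fderiv ℝ u z 1 := ⟨_, rfl⟩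
  have hw₀U' : ContDiffOn ℝ ∞ w₀ U' := by
    rw [hw₀_def]; exact hDu.clm_apply contDiffOn_const
  have happ : ∀ v : ℂ, (fun y => fderiv ℝ u y v) = (ContinuousLinearMap.apply ℝ E v) ∘ fderiv ℝ u :=
    fun v => rfl
  have heq : ∀ z ∈ U', fderiv ℝ w₀ z I = Jt z (fderiv ℝ w₀ z 1) + fderiv ℝ Jt z 1 (w₀ z) := by
    intro z hz
    have hd : DifferentiableAt ℝ (fderiv ℝ u) z :=
      (hDu.contDiffAt (hU'nhds z hz)).differentiableAt (by simp)
    have e1 : ∀ v h : ℂ, fderiv ℝ (fun y => fderiv ℝ u y v) z h = fderiv ℝ (fderiv ℝ u) z h v := by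
      intro v h
      rw [happ v, ((ContinuousLinearMap.apply ℝ E v).hasFDerivAt.comp z hd.hasFDerivAt).fderiv]
      simp
    -- symmetry of second derivatives: `∂_y ∂ₓ u = ∂ₓ ∂_y u`
    have hsymm : fderiv ℝ w₀ z I = fderiv ℝ (fun y => fderiv ℝ u y I) z 1 := by
      have hs : IsSymmSndFDerivAt ℝ u z :=
        (huU'.contDiffAt (hU'nhds z hz)).isSymmSndFDerivAt (by
          rw [minSmoothness_of_isRCLikeNormedField]; exact WithTop.coe_le_coe.mpr le_top)
      rw [hw₀_def, e1, e1, hs I 1]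
    -- product rule on `y ↦ Jt y (w₀ y)`, which agrees with `∂_y u` near `z`
    have hJd : HasFDerivAt Jt (fderiv ℝ Jt z) z :=
      ((hJtU'.contDiffAt (hU'nhds z hz)).differentiableAt (by simp)).hasFDerivAt
    have hwd : HasFDerivAt w₀ (fderiv ℝ w₀ z) z :=
      ((hw₀U'.contDiffAt (hU'nhds z hz)).differentiableAt (by simp)).hasFDerivAt
    have hprod : HasFDerivAt (fun y => Jt y (w₀ y))
        ((Jt z).comp (fderiv ℝ w₀ z) + (fderiv ℝ Jt z).flip (w₀ z)) z := hJd.clm_apply hwd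
    have hev : (fun y => fderiv ℝ u y I) =ᶠ[𝓝 z] fun y => Jt y (w₀ y) := by
      filter_upwards [hU'nhds z hz] with y hy
      rw [hhol y (hU'U hy), hw₀_def]
    rw [hsymm, hev.fderiv_eq, hprod.fderiv]
    simp
  -- the base complex structure and the frame `Φ = ½(1 - Jt J₀)`
  set J₀ : E →L[ℝ] E := Jt z₀ with hJ₀
  have hJ₀2 : ∀ v, J₀ (J₀ v) = -v := hJ2 z₀ hz₀U
  obtain ⟨Φ, hΦ_def⟩ : ∃ Φ : ℂ → E →L[ℝ] E, Φ = fun z => (1 / 2 : ℝ) • (1 - Jt z * J₀) :=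
    ⟨_, rfl⟩
  have hΦU' : ContDiffOn ℝ ∞ Φ U' := by
    rw [hΦ_def]
    exact (contDiffOn_const.sub (hJtU'.mul contDiffOn_const)).const_smul (1 / 2 : ℝ)
  have hΦz₀ : Φ z₀ = 1 := by
    rw [hΦ_def]
    ext x
    show (1 / 2 : ℝ) • (x - J₀ (J₀ x)) = x
    rw [hJ₀2, sub_neg_eq_add, ← two_smul ℝ x, smul_smul]
    norm_num
  have hcomm : ∀ z ∈ U', ∀ x, Jt z (Φ z x) = Φ z (J₀ x) := fun z hz x => by
    rw [hΦ_def]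
    show Jt z ((1 / 2 : ℝ) • (x - Jt z (J₀ x))) = (1 / 2 : ℝ) • (J₀ x - Jt z (J₀ (J₀ x)))
    rw [map_smul, map_sub, hJ2 z (hU'U hz), hJ₀2, map_neg]
    congr 1
    abel
  -- the open set `V ⊆ U'` where `Φ` is invertible, and the inverse frame `Ψ`
  set V : Set ℂ := U' ∩ Φ ⁻¹' {x | IsUnit x} with hV
  have hVopen : IsOpen V := hΦU'.continuousOn.isOpen_inter_preimage hU'open Units.isOpen
  have hz₀V : z₀ ∈ V := ⟨hz₀U', by simp [hΦz₀]⟩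
  have hVU' : V ⊆ U' := fun z hz => hz.1
  have hVnhds : ∀ z ∈ V, V ∈ 𝓝 z := fun z hz => hVopen.mem_nhds hz
  obtain ⟨Ψ, hΨ_def⟩ : ∃ Ψ : ℂ → E →L[ℝ] E, Ψ = fun z => Ring.inverse (Φ z) := ⟨_, rfl⟩
  have hΨΦ : ∀ z ∈ V, ∀ x, Ψ z (Φ z x) = x := by
    intro z hz x
    rw [hΨ_def]
    show (Ring.inverse (Φ z) * Φ z) x = x
    rw [Ring.inverse_mul_cancel _ hz.2]
    rfl
  have hΦΨ : ∀ z ∈ V, ∀ x, Φ z (Ψ z x) = x := by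
    intro z hz x
    rw [hΨ_def]
    show (Φ z * Ring.inverse (Φ z)) x = x
    rw [Ring.mul_inverse_cancel _ hz.2]
    rfl
  have hΨV : ContDiffOn ℝ ∞ Ψ V := by
    intro z hz
    obtain ⟨uΦ, huΦ⟩ := hz.2
    have h1 : ContDiffAt ℝ ∞ Ring.inverse (Φ z) := by
      rw [← huΦ]; exact contDiffAt_ringInverse ℝ uΦ
    rw [hΨ_def]
    exact h1.comp_contDiffWithinAt z ((hΦU' z hz.1).mono hVU')
  -- a ball `ball z₀ R₀ ⊆ V` and the working radius `R = R₀ / 2`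
  obtain ⟨R₀, hR₀, hballV⟩ := Metric.isOpen_iff.mp hVopen z₀ hz₀V
  set R : ℝ := R₀ / 2 with hR
  have hRpos : 0 < R := by positivity
  have hcbV : closedBall z₀ R ⊆ V := fun z hz =>
    hballV (mem_ball.mpr (lt_of_le_of_lt (mem_closedBall.mp hz) (by rw [hR]; linarith)))
  have hbV : ball z₀ R ⊆ V := ball_subset_closedBall.trans hcbV
  -- the function `w = Ψ w₀`
  obtain ⟨w, hw_def⟩ : ∃ w : ℂ → E, w = fun z => Ψ z (w₀ z) := ⟨_, rfl⟩
  have hwV : ContDiffOn ℝ ∞ w V := by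
    rw [hw_def]; exact hΨV.clm_apply (hw₀U'.mono hVU')
  have hw₀w : ∀ z ∈ V, w₀ z = Φ z (w z) := fun z hz => by rw [hw_def, hΦΨ z hz]
  -- derivatives on `V`
  have hw₀d : ∀ z ∈ V, HasFDerivAt w₀ (fderiv ℝ w₀ z) z := fun z hz =>
    (((hw₀U'.mono hVU').contDiffAt (hVnhds z hz)).differentiableAt (by simp)).hasFDerivAt
  have hwd : ∀ z ∈ V, HasFDerivAt w (fderiv ℝ w z) z := fun z hz =>
    ((hwV.contDiffAt (hVnhds z hz)).differentiableAt (by simp)).hasFDerivAt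
  have hΦd : ∀ z ∈ V, HasFDerivAt Φ (fderiv ℝ Φ z) z := fun z hz =>
    (((hΦU'.mono hVU').contDiffAt (hVnhds z hz)).differentiableAt (by simp)).hasFDerivAt
  have hDw₀ : ∀ z ∈ V, ∀ ζ, fderiv ℝ w₀ z ζ = Φ z (fderiv ℝ w z ζ) + fderiv ℝ Φ z ζ (w z) := by
    intro z hz ζ
    have h2 : HasFDerivAt (fun y => Φ y (w y))
        ((Φ z).comp (fderiv ℝ w z) + (fderiv ℝ Φ z).flip (w z)) z :=
      (hΦd z hz).clm_apply (hwd z hz)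
    have hev : w₀ =ᶠ[𝓝 z] fun y => Φ y (w y) := by
      filter_upwards [hVnhds z hz] with y hy using hw₀w y hy
    have h3 := (hw₀d z hz).unique (h2.congr_of_eventuallyEq hev)
    rw [h3]
    simp
  -- the key identity `∂_y w - J₀ ∂ₓ w = Ψ (Jt (∂ₓΦ) w + (∂ₓJt) (Φ w) - (∂_yΦ) w)` on `V`
  have hkey : ∀ z ∈ V, fderiv ℝ w z I - J₀ (fderiv ℝ w z 1) =
      Ψ z (Jt z (fderiv ℝ Φ z 1 (w z)) + fderiv ℝ Jt z 1 (Φ z (w z))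
        - fderiv ℝ Φ z I (w z)) := by
    intro z hz
    have hzU' : z ∈ U' := hVU' hz
    have h := heq z hzU'
    rw [hDw₀ z hz I, hDw₀ z hz 1, map_add, hcomm z hzU', hw₀w z hz] at h
    -- `h : Φ (Dw I) + DΦ I w = Φ (J₀ (Dw 1)) + Jt (DΦ 1 w) + DJt 1 (Φ w)`
    have h' : Φ z (fderiv ℝ w z I - J₀ (fderiv ℝ w z 1)) =
        Jt z (fderiv ℝ Φ z 1 (w z)) + fderiv ℝ Jt z 1 (Φ z (w z)) - fderiv ℝ Φ z I (w z) := by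
      rw [map_sub]
      exact sub_eq_sub_iff_add_eq_add.mpr (by rw [h]; abel)
    calc fderiv ℝ w z I - J₀ (fderiv ℝ w z 1)
        = Ψ z (Φ z (fderiv ℝ w z I - J₀ (fderiv ℝ w z 1))) := (hΨΦ z hz _).symm
      _ = _ := by rw [h']
  -- sup bounds on the closed disc `closedBall z₀ R ⊆ V`
  have hK : IsCompact (closedBall z₀ R) := isCompact_closedBall _ _
  have hΨcont : ContinuousOn Ψ (closedBall z₀ R) := hΨV.continuousOn.mono hcbV
  have hΦcont : ContinuousOn Φ (closedBall z₀ R) := hΦU'.continuousOn.mono (hcbV.trans hVU')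
  have hJcont : ContinuousOn Jt (closedBall z₀ R) := hJtU'.continuousOn.mono (hcbV.trans hVU')
  have hDΦcont : ContinuousOn (fderiv ℝ Φ) (closedBall z₀ R) :=
    ((hΦU'.mono hVU').continuousOn_fderiv_of_isOpen hVopen (by simp)).mono hcbV
  have hDJcont : ContinuousOn (fderiv ℝ Jt) (closedBall z₀ R) :=
    ((hJtU'.mono hVU').continuousOn_fderiv_of_isOpen hVopen (by simp)).mono hcbV
  obtain ⟨MΨ, hMΨ⟩ := hK.exists_bound_of_continuousOn hΨcont
  obtain ⟨MΦ₀, hMΦ₀⟩ := hK.exists_bound_of_continuousOn hΦcont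
  obtain ⟨MJ, hMJ⟩ := hK.exists_bound_of_continuousOn hJcont
  obtain ⟨MΦ, hMΦ⟩ := hK.exists_bound_of_continuousOn (f := fderiv ℝ Φ) hDΦcont
  obtain ⟨MA, hMA⟩ := hK.exists_bound_of_continuousOn (f := fderiv ℝ Jt) hDJcont
  have hz₀K : z₀ ∈ closedBall z₀ R := mem_closedBall_self hRpos.le
  have hMΨnn : 0 ≤ MΨ := (norm_nonneg _).trans (hMΨ z₀ hz₀K)
  have hMΦ₀nn : 0 ≤ MΦ₀ := (norm_nonneg _).trans (hMΦ₀ z₀ hz₀K)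
  have hMJnn : 0 ≤ MJ := (norm_nonneg _).trans (hMJ z₀ hz₀K)
  have hMΦnn : 0 ≤ MΦ := (norm_nonneg _).trans (hMΦ z₀ hz₀K)
  have hMAnn : 0 ≤ MA := (norm_nonneg _).trans (hMA z₀ hz₀K)
  obtain ⟨C, hC⟩ : ∃ C : ℝ, C = ‖J₀‖ * MΨ * (MJ * MΦ + MA * MΦ₀ + MΦ) := ⟨_, rfl⟩
  have hCnn : 0 ≤ C := by rw [hC]; positivity
  have hineq : ∀ z ∈ ball z₀ R, ‖fderiv ℝ w z 1 + J₀ (fderiv ℝ w z I)‖ ≤ C * ‖w z‖ := by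
    intro z hz
    have hzK : z ∈ closedBall z₀ R := ball_subset_closedBall hz
    have hzV : z ∈ V := hbV hz
    have hid : fderiv ℝ w z 1 + J₀ (fderiv ℝ w z I) =
        J₀ (fderiv ℝ w z I - J₀ (fderiv ℝ w z 1)) := by
      rw [map_sub, hJ₀2]; abel
    rw [hid, hkey z hzV]
    have hΦe : ∀ e : ℂ, ‖e‖ = 1 → ‖fderiv ℝ Φ z e (w z)‖ ≤ MΦ * ‖w z‖ := by
      intro e he
      calc ‖fderiv ℝ Φ z e (w z)‖ ≤ ‖fderiv ℝ Φ z e‖ * ‖w z‖ :=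
            ContinuousLinearMap.le_opNorm _ _
        _ ≤ (‖fderiv ℝ Φ z‖ * ‖e‖) * ‖w z‖ := by
            gcongr; exact ContinuousLinearMap.le_opNorm _ _
        _ ≤ MΦ * ‖w z‖ := by rw [he, mul_one]; gcongr; exact hMΦ z hzK
    have h1 := hΦe 1 norm_one
    have h2 := hΦe I Complex.norm_I
    have h3 : ‖Jt z (fderiv ℝ Φ z 1 (w z))‖ ≤ MJ * (MΦ * ‖w z‖) :=
      (ContinuousLinearMap.le_opNorm _ _).trans
        (mul_le_mul (hMJ z hzK) h1 (norm_nonneg _) hMJnn)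
    have h4' : ‖fderiv ℝ Jt z 1 (Φ z (w z))‖ ≤ MA * (MΦ₀ * ‖w z‖) := by
      calc ‖fderiv ℝ Jt z 1 (Φ z (w z))‖ ≤ ‖fderiv ℝ Jt z 1‖ * ‖Φ z (w z)‖ :=
            ContinuousLinearMap.le_opNorm _ _
        _ ≤ (‖fderiv ℝ Jt z‖ * ‖(1 : ℂ)‖) * (‖Φ z‖ * ‖w z‖) := by
            gcongr
            · exact ContinuousLinearMap.le_opNorm _ _
            · exact ContinuousLinearMap.le_opNorm _ _
        _ ≤ MA * (MΦ₀ * ‖w z‖) := by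
            rw [norm_one, mul_one]
            gcongr
            · exact hMA z hzK
            · exact hMΦ₀ z hzK
    have h5 : ‖Jt z (fderiv ℝ Φ z 1 (w z)) + fderiv ℝ Jt z 1 (Φ z (w z))
        - fderiv ℝ Φ z I (w z)‖ ≤ (MJ * MΦ + MA * MΦ₀ + MΦ) * ‖w z‖ := by
      calc ‖Jt z (fderiv ℝ Φ z 1 (w z)) + fderiv ℝ Jt z 1 (Φ z (w z)) - fderiv ℝ Φ z I (w z)‖
          ≤ ‖Jt z (fderiv ℝ Φ z 1 (w z)) + fderiv ℝ Jt z 1 (Φ z (w z))‖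
              + ‖fderiv ℝ Φ z I (w z)‖ := norm_sub_le _ _
        _ ≤ ‖Jt z (fderiv ℝ Φ z 1 (w z))‖ + ‖fderiv ℝ Jt z 1 (Φ z (w z))‖
              + ‖fderiv ℝ Φ z I (w z)‖ := by gcongr; exact norm_add_le _ _
        _ ≤ MJ * (MΦ * ‖w z‖) + MA * (MΦ₀ * ‖w z‖) + MΦ * ‖w z‖ :=
              add_le_add (add_le_add h3 h4') h2
        _ = (MJ * MΦ + MA * MΦ₀ + MΦ) * ‖w z‖ := by ring
    have h6 : ‖Ψ z (Jt z (fderiv ℝ Φ z 1 (w z)) + fderiv ℝ Jt z 1 (Φ z (w z))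
        - fderiv ℝ Φ z I (w z))‖ ≤ MΨ * ((MJ * MΦ + MA * MΦ₀ + MΦ) * ‖w z‖) :=
      (ContinuousLinearMap.le_opNorm _ _).trans
        (mul_le_mul (hMΨ z hzK) h5 (norm_nonneg _) hMΨnn)
    calc ‖J₀ (Ψ z (Jt z (fderiv ℝ Φ z 1 (w z)) + fderiv ℝ Jt z 1 (Φ z (w z))
          - fderiv ℝ Φ z I (w z)))‖
        ≤ ‖J₀‖ * ‖Ψ z (Jt z (fderiv ℝ Φ z 1 (w z)) + fderiv ℝ Jt z 1 (Φ z (w z))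
          - fderiv ℝ Φ z I (w z))‖ := ContinuousLinearMap.le_opNorm _ _
      _ ≤ ‖J₀‖ * (MΨ * ((MJ * MΦ + MA * MΦ₀ + MΦ) * ‖w z‖)) :=
          mul_le_mul_of_nonneg_left h6 (norm_nonneg _)
      _ = C * ‖w z‖ := by rw [hC]; ring
  -- complex coordinates adapted to `J₀` and the `∂̄`-inequality for `v = S⁻¹ w`
  obtain ⟨S, hS⟩ := exists_complexCoordinates h4 J₀ hJ₀2
  obtain ⟨v, hv_def⟩ : ∃ v : ℂ → ℂ × ℂ, v = fun z => S.symm (w z) := ⟨_, rfl⟩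
  have hwv : ∀ z, w z = S (v z) := fun z => by
    rw [hv_def, ContinuousLinearEquiv.apply_symm_apply]
  have hvd : ContDiffOn ℝ ∞ v (ball z₀ R) := by
    rw [hv_def]; exact S.symm.contDiff.comp_contDiffOn (hwV.mono hbV)
  have hDv : ∀ z ∈ ball z₀ R, ∀ ζ, fderiv ℝ v z ζ = S.symm (fderiv ℝ w z ζ) := by
    intro z hz ζ
    rw [hv_def]
    show fderiv ℝ ((S.symm : E → ℂ × ℂ) ∘ w) z ζ = _
    rw [(S.symm.hasFDerivAt.comp z (hwd z (hbV hz))).fderiv]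
    rfl
  have hSymmJ : ∀ x : E, S.symm (J₀ x) = I • S.symm x := by
    intro x
    have h := hS (S.symm x)
    rw [ContinuousLinearEquiv.apply_symm_apply] at h
    rw [h, ContinuousLinearEquiv.symm_apply_apply]
  set C' : ℝ := ‖(S.symm : E →L[ℝ] ℂ × ℂ)‖ * C * ‖(S : ℂ × ℂ →L[ℝ] E)‖ with hC'
  have hineq' : ∀ z ∈ ball z₀ R,
      ‖fderiv ℝ v z 1 + Complex.I • fderiv ℝ v z Complex.I‖ ≤ C' * ‖v z‖ := by
    intro z hz
    have e : fderiv ℝ v z 1 + I • fderiv ℝ v z I =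
        S.symm (fderiv ℝ w z 1 + J₀ (fderiv ℝ w z I)) := by
      rw [hDv z hz, hDv z hz, map_add, hSymmJ]
    rw [e]
    calc ‖S.symm (fderiv ℝ w z 1 + J₀ (fderiv ℝ w z I))‖
        ≤ ‖(S.symm : E →L[ℝ] ℂ × ℂ)‖ * ‖fderiv ℝ w z 1 + J₀ (fderiv ℝ w z I)‖ :=
          (S.symm : E →L[ℝ] ℂ × ℂ).le_opNorm _
      _ ≤ ‖(S.symm : E →L[ℝ] ℂ × ℂ)‖ * (C * ‖w z‖) := by gcongr; exact hineq z hz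
      _ ≤ ‖(S.symm : E →L[ℝ] ℂ × ℂ)‖ * (C * (‖(S : ℂ × ℂ →L[ℝ] E)‖ * ‖v z‖)) := by
          gcongr
          rw [hwv z]
          exact (S : ℂ × ℂ →L[ℝ] E).le_opNorm _
      _ = C' * ‖v z‖ := by rw [hC']; ring
  -- the vector-valued similarity principle
  have hdich := Literature.Analysis.Complex.zeroDichotomy_of_norm_dbar_le_normedSpace
    (G := ℂ × ℂ) hRpos hvd hineq'
  -- `du z ζ = (Re ζ) ∂ₓu + (Im ζ) Jt (∂ₓu)` on `U`
  have hDu_repr : ∀ z ∈ U, ∀ ζ : ℂ, fderiv ℝ u z ζ = ζ.re • w₀ z + ζ.im • Jt z (w₀ z) := by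
    intro z hz ζ
    have e : ζ = (ζ.re : ℝ) • (1 : ℂ) + (ζ.im : ℝ) • I := by
      simp only [Complex.real_smul, mul_one]
      exact (Complex.re_add_im ζ).symm
    conv_lhs => rw [e]
    rw [map_add, map_smul, map_smul, hhol z hz, hw₀_def]
  rcases hdich with h0 | hne
  · -- `v ≡ 0` near `z₀`: then `du ≡ 0` near `z₀` and `u` is constant near `z₀` — excluded
    exfalso
    obtain ⟨r, hr, hrb⟩ : ∃ r > 0, ∀ z ∈ ball z₀ r, v z = 0 ∧ z ∈ V ∧ z ∈ U := by
      have hV' : ∀ᶠ z in 𝓝 z₀, z ∈ V := hVopen.mem_nhds hz₀V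
      have hU' : ∀ᶠ z in 𝓝 z₀, z ∈ U := hU
      have hev : ∀ᶠ z in 𝓝 z₀, v z = 0 ∧ z ∈ V ∧ z ∈ U := h0.and (hV'.and hU')
      exact Metric.eventually_nhds_iff_ball.1 hev
    have hDu0 : ∀ z ∈ ball z₀ r, fderiv ℝ u z = 0 := by
      intro z hz
      obtain ⟨hvz, hzV, hzU⟩ := hrb z hz
      have hw0 : w₀ z = 0 := by rw [hw₀w z hzV, hwv z, hvz, map_zero, map_zero]
      ext ζ
      rw [hDu_repr z hzU ζ, hw0, map_zero, smul_zero, smul_zero, add_zero]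
      rfl
    have hconst : ∀ z ∈ ball z₀ r, u z = u z₀ := by
      intro z hz
      have hdiff : DifferentiableOn ℝ u (ball z₀ r) := fun y hy =>
        ((hu.contDiffAt (Filter.mem_of_superset (hVopen.mem_nhds (hrb y hy).2.1)
          (fun x hx => hU'U (hVU' hx)))).differentiableAt (by simp)).differentiableWithinAt
      exact (convex_ball z₀ r).is_const_of_fderivWithin_eq_zero hdiff
        (fun y hy => by rw [fderivWithin_of_isOpen isOpen_ball hy]; exact hDu0 y hy) hz
        (mem_ball_self hr)
    have hev : ∀ᶠ z in 𝓝 z₀, u z = u z₀ := by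
      filter_upwards [ball_mem_nhds z₀ hr] with z hz using hconst z hz
    obtain ⟨z, hz1, hz2⟩ := (hnc.and_eventually hev).exists
    exact hz1 hz2
  · -- `v ≠ 0` on a punctured neighbourhood: there `∂ₓ u ≠ 0` and `du` is injective
    filter_upwards [hne, mem_nhdsWithin_of_mem_nhds (hVopen.mem_nhds hz₀V),
      mem_nhdsWithin_of_mem_nhds hU] with z hvz hzV hzU
    have hw0 : w₀ z ≠ 0 := by
      intro h
      apply hvz
      have : w z = 0 := by rw [← hΨΦ z hzV (w z), ← hw₀w z hzV, h, map_zero]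
      rw [hv_def]
      show S.symm (w z) = 0
      rw [this, map_zero]
    refine injective_of_map_I_mul (Jt z) (hJ2 z hzU) (fderiv ℝ u z) (fun ζ => ?_) (by
      have h := hw0; rwa [hw₀_def] at h)
    rw [hDu_repr z hzU, hDu_repr z hzU, map_add, map_smul, map_smul, hJ2 z hzU]
    simp only [Complex.mul_re, Complex.I_re, Complex.I_im, Complex.mul_im, zero_mul, one_mul,
      zero_sub, zero_add, neg_smul, smul_neg]
    abel

end Flat

end CriticalPoints

/-! ### The manifold statement -/

section Manifold

/-- **Critical points of a `J`-holomorphic curve are isolated (McDuff 1991, Lemma 2.7, first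
statement).** In a smooth almost complex `4`-manifold `(V, J)` (`J² = -1`, `J` smooth in
tangent coordinates), let `G : ℂ → V` be smooth and `J`-holomorphic and not locally constant at
`z₀`. Then `dG(z)` is injective for every `z ≠ z₀` sufficiently close to `z₀`. Source: McDuff,
JDG 34 (1991), Lemma 2.7 p. 150 ("All critical points of a `J`-holomorphic map `f : D → V` are
isolated"); here for germs of entire maps, in the vocabulary of the facts of
`JHolomorphicLocalIntersections.lean`. [cite: McDuff1991LocalBehaviour, Lemma 2.7] -/
theorem IsJHolomorphic.eventually_injective_mfderiv {V : Type*} [TopologicalSpace V]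
    [ChartedSpace (EuclideanSpace ℝ (Fin 4)) V] [IsManifold (𝓡 4) ∞ V]
    {J : ∀ x : V, TangentSpace (𝓡 4) x →L[ℝ] TangentSpace (𝓡 4) x}
    (hJ2 : ∀ (x : V) (v : TangentSpace (𝓡 4) x), J x (J x v) = -v)
    (hJsm : ∀ x₀ : V, ContMDiffAt (𝓡 4)
      𝓘(ℝ, EuclideanSpace ℝ (Fin 4) →L[ℝ] EuclideanSpace ℝ (Fin 4)) ∞
      (inTangentCoordinates (𝓡 4) (𝓡 4) (id : V → V) id (fun x => J x) x₀) x₀)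
    {G : ℂ → V} (hG : ContMDiff 𝓘(ℝ, ℂ) (𝓡 4) ∞ G) (hGJ : IsJHolomorphic (𝓡 4) J G)
    {z₀ : ℂ} (hnc : ∃ᶠ z in 𝓝 z₀, G z ≠ G z₀) :
    ∀ᶠ z in 𝓝[≠] z₀, Injective (mfderiv 𝓘(ℝ, ℂ) (𝓡 4) G z) := by
  set x₀ : V := G z₀ with hx₀
  obtain ⟨Jc, hJc, hJc2, hJcJ⟩ := ChartLocalisation.exists_chartJ J hJ2 hJsm x₀
  set φ := extChartAt (𝓡 4) x₀ with hφ
  set Src : Set V := (chartAt (EuclideanSpace ℝ (Fin 4)) x₀).source with hSrc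
  have hSo : IsOpen Src := (chartAt (EuclideanSpace ℝ (Fin 4)) x₀).open_source
  have hx₀S : x₀ ∈ Src := mem_chart_source (EuclideanSpace ℝ (Fin 4)) x₀
  have hSsrc : Src = φ.source := by rw [hφ, extChartAt_source]
  -- the open neighbourhood `U = G ⁻¹' Src` of `z₀` and the chart expressions
  set U : Set ℂ := G ⁻¹' Src with hU
  have hUo : IsOpen U := hSo.preimage hG.continuous
  have hz₀U : z₀ ∈ U := hx₀S
  have hUn : U ∈ 𝓝 z₀ := hUo.mem_nhds hz₀U
  set u : ℂ → EuclideanSpace ℝ (Fin 4) := fun z => φ (G z) with hu_def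
  set Jt : ℂ → EuclideanSpace ℝ (Fin 4) →L[ℝ] EuclideanSpace ℝ (Fin 4) := fun z => Jc (u z)
    with hJt_def
  have hu : ContDiffOn ℝ ∞ u U := fun z hz =>
    (ChartLocalisation.contDiffAt_chart (hG z) hz).contDiffWithinAt
  have hmaps : MapsTo u U φ.target := fun z hz => φ.map_source (by rw [← hSsrc]; exact hz)
  have hJt : ContDiffOn ℝ ∞ Jt U := hJc.comp hu hmaps
  have hJ2' : ∀ z ∈ U, ∀ v, Jt z (Jt z v) = -v := fun z hz v => hJc2 _ (hmaps hz) v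
  have hhol : ∀ z ∈ U, fderiv ℝ u z I = Jt z (fderiv ℝ u z 1) := by
    intro z hz
    have h := ChartLocalisation.fderiv_chart_I_mul J (hG z) (hGJ z) hz 1
    rw [mul_one] at h
    show fderiv ℝ (fun w => φ (G w)) z I = Jc (φ (G z)) (fderiv ℝ (fun w => φ (G w)) z 1)
    rw [hJcJ _ hz]
    exact h
  have hnc' : ∃ᶠ z in 𝓝 z₀, u z ≠ u z₀ := by
    have hev : ∀ᶠ z in 𝓝 z₀, z ∈ U := hUn
    refine (hnc.and_eventually hev).mono fun z hz huz => hz.1 ?_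
    exact φ.injOn (by rw [← hSsrc]; exact hz.2) (by rw [← hSsrc]; exact hz₀U) huz
  have key := CriticalPoints.eventually_injective_fderiv_of_frequently_ne
    (E := EuclideanSpace ℝ (Fin 4)) (by simp) hUn hu hJt hJ2' hhol hnc'
  filter_upwards [key, mem_nhdsWithin_of_mem_nhds hUn] with z hz hzU
  have e : ⇑(fderiv ℝ u z) =
      (mfderiv (𝓡 4) 𝓘(ℝ, EuclideanSpace ℝ (Fin 4)) φ (G z)) ∘ (mfderiv 𝓘(ℝ, ℂ) (𝓡 4) G z) :=
    funext fun v => ChartLocalisation.fderiv_extChartAt_comp_apply (hG z) hzU v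
  rw [e] at hz
  exact hz.of_comp

end Manifold

end Literature.Geometry.Symplectic

end
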